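import Summits.QuantumFields.BalabanUV.Beta.FP.HorizontalRemainderPerfect
import Summits.QuantumFields.BalabanUV.Beta.FP.HorizontalRemainderFarFine

/-!
# `BalabanUV.Beta.FP.RemainderLedger` — road «FP» for binder row D1, row **GAMMA-8** (owner END, organisation γ): THE (rem) LEDGER —
# the remainder `T − Xtr` of the γ-END is delivered PIECE BY PIECE (gluon bubble ∕ tadpole ∕ slice-vertex loops, MIX-1…4, multiplier vertex,
# ghost (g1)–(g5), normalisation, far-fine), each by its own engine in (rem) or (pp) currency; this module is the FINITE-FAMILY assembler and the
# resulting `hbook` ∕ `hasym` AT THE PERFECT COLUMNS from a displayed SPLIT hypothesis `T m − Xtr_m = Σ_{i∈I} D i m` (row KER-γ's output shape)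
# and per-piece letters — so every supplier sees the exact socket its piece must fill

HONEST DEPENDENCY (page 1, mandatory): continuum YM on T⁴ ⇐ BetaPertH ∧ nine spine estimates (0/9 proved); BetaPertH ⇐ (D1) ∧ (D4) ∧
CAP+tail; G-an2-4 gates asym, D1 and NE2/3/4.  HONEST FRAMING (cell contract, verbatim): «discharging `BetaPertH` makes Bałaban's UV
stability UNCONDITIONAL — a real constructive-QFT result; it is NOT the continuum limit and NOT the Clay problem.»  THIS MODULE is [folklore]
finite-sum bookkeeping (`Finset.induction_on` over the binary assembler `HorizontalRemainderFarFine.rem_add`) composed BY NAME with the owner's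
`FP/HorizontalRemainderPerfect.hbook_perfect_of_remainder` ∕ `hasym_perfect_of_remainder` (p246122 ✓) and leaf-05-g12's (pp→rem) glue
`HorizontalBookkeepingPaired.sum_sq_mul_abs_le_of_pointwise_exp`.  No `def`, no `def … : Prop`, nothing cited, 0 sorry.  The SPLIT `hsplit` and every piece
letter are HYPOTHESES (suppliers: KER-γ (α) for the split with the road's piece list; GAMMA-5∕6, RHOA-6c′∕6e, RHOA-7, (GH-a), GAMMA-7, RHOA-4c for the pieces).
NOT hbook-discharged, NOT hasym, NOT D1, NOT BetaPertH, NOT continuum, NOT Clay.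

ABSOLUTE RULE (cell charter, verbatim): «No internally-minted statement may enter as a cited fact. Every hypothesis is either kernel-proved in this
package or a verbatim quotation of a PUBLISHED theorem with page reference. The manuscript(s) under audit are NOT citable for their own disputed
steps — they are the thing under adjudication; programme-internal (2001/route/tribunal) claims are never citable.»

CONTENT.
* §1 [folklore] **`rem_sum`** (a finite family of pieces, each with a (rem) bound `B i`, has the (rem) bound `Σ B i`), `rem_of_split` (the same read on
  `T μ ν − Xtr` through a displayed split); a (pp) piece is converted to a (rem) piece BY NAME with leaf-05-g12's
  `HorizontalBookkeepingPaired.sum_sq_mul_abs_le_of_pointwise_exp` (`B·(1 + 9600·e^{δ/2}·(2/δ)⁶)`) before entering the ledger.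
* §2 [our object] **`hbook_perfect_of_pieces`** ∕ **`hasym_perfect_of_pieces`** (`d = 3`, `2 ≤ Lc`): the three `K`-letters (sextic, even, Ward-(T0)) + an
  m-UNIFORM split of `T m − Xtr_m` at the PERFECT columns into a finite family with m-uniform per-piece (rem) bounds ⟹ `∃ U₀ ≥ 0` m-free with
  `|secondMoment (T m) μ ν − g(Lc^m)| ≤ U₀ + Σ_{i∈I} B i` (+ `hgerm` ⟹ `|secondMoment (T m) μ ν − m·(s·log Lc)| ≤ (U₀ + Σ B i) + Cg + |c₀|`).
Provenance: road FP OWNER b2b-balaban-beta-d1-p3 gen 8 (prover-b2b-balaban-beta-d1-p3-g8-0), 2026-08-21, row GAMMA-8; «not in print; our bookkeeping».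
-/

noncomputable section

namespace Summit.QuantumFields.BalabanUV.Beta.FP.RemainderLedger

open Finset Filter Topology
open scoped BigOperators
open Literature.Probability.LatticeModels (box annulus)
open Literature.MathematicalPhysics.QuantumFieldTheory.Balaban1983to89
open Literature.MathematicalPhysics.QuantumFieldTheory.Balaban1983to89.Beta
open DyadicShell (Pt supNorm)
open DressedMomentNormalisation (EKer dressedEntry)
open Summit.QuantumFields.BalabanUV.Beta.GAN24.CombesThomas (sfStep smStep)
open Summit.QuantumFields.BalabanUV.Beta.FP.PerfectObjectsT (KPerf)
open Summit.QuantumFields.BalabanUV.Beta.FP.TransportInfinityM (colOf)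
open Summit.QuantumFields.BalabanUV.Beta.FP.HorizontalBookkeeping (truncK)
open Summit.QuantumFields.BalabanUV.Beta.FP.HorizontalRemainderFarFine (rem_add)
open Summit.QuantumFields.BalabanUV.Beta.FP.HorizontalRemainderPerfect (hbook_perfect_of_remainder hasym_perfect_of_remainder)

/-! ## §1 The finite-family assembler in (rem) currency -/

/-- [folklore] **THE (rem) LEDGER**: a finite family of pieces `D i`, each with `Σ_{v∈S} ‖v‖∞²·|D i v| ≤ B i` for every finite `S`, sums to a piece
with the bound `Σ_{i∈I} B i`. -/
theorem rem_sum {ι : Type*} (I : Finset ι) {D : ι → Pt → ℝ} {B : ι → ℝ}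
    (h : ∀ i ∈ I, ∀ S : Finset Pt, ∑ v ∈ S, (supNorm v : ℝ) ^ 2 * |D i v| ≤ B i) :
    ∀ S : Finset Pt, ∑ v ∈ S, (supNorm v : ℝ) ^ 2 * |∑ i ∈ I, D i v| ≤ ∑ i ∈ I, B i := by
  classical
  induction I using Finset.induction_on with
  | empty => intro S; simp
  | @insert a I ha ih =>
      intro S
      have hI : ∀ i ∈ I, ∀ S : Finset Pt, ∑ v ∈ S, (supNorm v : ℝ) ^ 2 * |D i v| ≤ B i :=
        fun i hi => h i (Finset.mem_insert_of_mem hi)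
      have hstep := rem_add (A := D a) (B := fun v => ∑ i ∈ I, D i v) (h a (Finset.mem_insert_self a I)) (ih hI) S
      simpa only [Finset.sum_insert ha] using hstep

/-- [folklore] **THE LEDGER READ ON THE REMAINDER**: if `T μ ν v − Xtr v = Σ_{i∈I} D i v` for every `v` and each piece has an (rem) bound `B i`, then
`Σ_{v∈S} ‖v‖∞²·|T μ ν v − Xtr v| ≤ Σ_{i∈I} B i` for every finite `S` — the hypothesis `hrem` of the γ-END. -/
theorem rem_of_split {T : Fin 4 → Fin 4 → Pt → ℝ} {Xtr : Pt → ℝ} {μ ν : Fin 4} {ι : Type*} (I : Finset ι) {D : ι → Pt → ℝ} {B : ι → ℝ}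
    (hsplit : ∀ v : Pt, T μ ν v - Xtr v = ∑ i ∈ I, D i v)
    (h : ∀ i ∈ I, ∀ S : Finset Pt, ∑ v ∈ S, (supNorm v : ℝ) ^ 2 * |D i v| ≤ B i) :
    ∀ S : Finset Pt, ∑ v ∈ S, (supNorm v : ℝ) ^ 2 * |T μ ν v - Xtr v| ≤ ∑ i ∈ I, B i := by
  intro S
  have h' := rem_sum I h S
  simpa only [hsplit] using h'

/-! ## §2 `hbook` and `hasym` at the perfect columns from a finite piece ledger -/

section Perfect

variable {Lc : ℕ} [NeZero Lc]

/-- **`hbook` AT THE PERFECT COLUMNS FROM A PIECE LEDGER** [our object] (`d = 3`, `2 ≤ Lc`): three kernel letters of `K` (sextic decay, evenness,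
`HasSum (K c e) 0`), a split `T m μ ν v − Xtr_m v = Σ_{i∈I} D i m v` for every `m ≥ 1` (with `Xtr_m` the truncated transport of `K` by the perfect columns
at blocking `Lc^m`), and m-UNIFORM per-piece (rem) bounds `B i` give an m-FREE `U₀ ≥ 0` with
`|secondMoment (T m) μ ν − Σ_{0<‖z‖∞≤Lc^m} K μ ν z·z_μ·z_ν| ≤ U₀ + Σ_{i∈I} B i` for every `m ≥ 1`. -/
theorem hbook_perfect_of_pieces (hLc : 2 ≤ Lc) {K : EKer 4} {C : ℝ}
    (hK : ∀ c' e (t : Pt), |K c' e t| ≤ C / ((supNorm t : ℝ) + 1) ^ 6)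
    (heven : ∀ c' e (t : Pt), K c' e (-t) = K c' e t) (hK0 : ∀ c' e, HasSum (K c' e) 0)
    {T : ℕ → Fin 4 → Fin 4 → Pt → ℝ} (μ ν : Fin 4) {ι : Type*} (I : Finset ι) {D : ι → ℕ → Pt → ℝ} {B : ι → ℝ}
    (hsplit : ∀ m : ℕ, 1 ≤ m → ∀ v : Pt,
      T m μ ν v - ((Lc ^ m : ℕ) : ℝ) ^ 8 * dressedEntry (colOf (KPerf (d := 3) Lc (sfStep Lc) (smStep 3 Lc) m))
          (truncK K (Lc ^ m)) (((Lc ^ m : ℕ) : ℤ) • v) μ ν = ∑ i ∈ I, D i m v)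
    (hpieces : ∀ i ∈ I, ∀ m : ℕ, 1 ≤ m → ∀ S : Finset Pt, ∑ v ∈ S, (supNorm v : ℝ) ^ 2 * |D i m v| ≤ B i) :
    ∃ U₀ : ℝ, 0 ≤ U₀ ∧ ∀ m : ℕ, 1 ≤ m →
      (Summable fun v : Pt => T m μ ν v * (v μ : ℝ) * (v ν : ℝ)) ∧
      |B12Beta.secondMoment (T m) μ ν - ∑ z ∈ annulus 4 0 (Lc ^ m), K μ ν z * (z μ : ℝ) * (z ν : ℝ)| ≤ U₀ + ∑ i ∈ I, B i :=
  hbook_perfect_of_remainder hLc hK heven hK0 (T := T) μ ν fun m hm =>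
    rem_of_split (T := T m) I (hsplit m hm) (fun i hi => hpieces i hi m hm)

/-- **`hasym` AT THE PERFECT COLUMNS FROM A PIECE LEDGER** [our object] (`d = 3`, `2 ≤ Lc`): `hbook_perfect_of_pieces` plus the windowed germ letter
`hgerm` ⟹ `∃ U₀ ≥ 0`, m-free, `|secondMoment (T m) μ ν − m·(s·log Lc)| ≤ (U₀ + Σ_{i∈I} B i) + Cg + |c₀|` for every `m ≥ 1` — the bounded (ASYMP)
hypothesis of `FixedPointIdentification` for `f m := secondMoment (T m) μ ν`, as a function of EXACTLY: three `K`-letters, the split, the piece ledger, `hgerm`. -/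
theorem hasym_perfect_of_pieces (hLc : 2 ≤ Lc) {K : EKer 4} {C : ℝ}
    (hK : ∀ c' e (t : Pt), |K c' e t| ≤ C / ((supNorm t : ℝ) + 1) ^ 6)
    (heven : ∀ c' e (t : Pt), K c' e (-t) = K c' e t) (hK0 : ∀ c' e, HasSum (K c' e) 0)
    {T : ℕ → Fin 4 → Fin 4 → Pt → ℝ} (μ ν : Fin 4) {ι : Type*} (I : Finset ι) {D : ι → ℕ → Pt → ℝ} {B : ι → ℝ}
    (hsplit : ∀ m : ℕ, 1 ≤ m → ∀ v : Pt,
      T m μ ν v - ((Lc ^ m : ℕ) : ℝ) ^ 8 * dressedEntry (colOf (KPerf (d := 3) Lc (sfStep Lc) (smStep 3 Lc) m))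
          (truncK K (Lc ^ m)) (((Lc ^ m : ℕ) : ℤ) • v) μ ν = ∑ i ∈ I, D i m v)
    (hpieces : ∀ i ∈ I, ∀ m : ℕ, 1 ≤ m → ∀ S : Finset Pt, ∑ v ∈ S, (supNorm v : ℝ) ^ 2 * |D i m v| ≤ B i)
    {s c₀ Cg : ℝ}
    (hgerm : ∀ M : ℕ, 1 ≤ M → |∑ z ∈ annulus 4 0 M, K μ ν z * (z μ : ℝ) * (z ν : ℝ) - (s * Real.log M + c₀)| ≤ Cg) :
    ∃ U₀ : ℝ, 0 ≤ U₀ ∧ ∀ m : ℕ, 1 ≤ m →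
      |B12Beta.secondMoment (T m) μ ν - (m : ℝ) * (s * Real.log Lc)| ≤ (U₀ + ∑ i ∈ I, B i) + Cg + |c₀| :=
  hasym_perfect_of_remainder hLc hK heven hK0 (T := T) μ ν
    (fun m hm => rem_of_split (T := T m) I (hsplit m hm) (fun i hi => hpieces i hi m hm)) hgerm

end Perfect

end Summit.QuantumFields.BalabanUV.Beta.FP.RemainderLedger

end
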